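import Literature.Probability.Percolation.LoopRepresentationUniversality
import HarnessLib

/-!
# The density step of the printed proof of DKKMO's Theorem 1.7

Proofs layer of `Literature.Probability.Percolation.LoopRepresentation`, continuing
`LoopRepresentationUniversality` (horizontal symmetry). The named fact `dkkmo_theorem_1_7` is
Theorem 1.7 of Duminil-Copin–Kozlowski–Krachun–Manolescu–Oulamara, arXiv:2012.11672v2 (2026),
at `q = 1`, `d_CN` part. Its printed proof (§4.2) runs:

> "Define the set `R = {α ∈ (0, π) : φ_{L(α)}` asymptotically similar to `φ_{L(π/2)}}`.
> Theorem 1.2 implies that `φ_{L(π/2)}` is asymptotically rotationally invariant. As a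
> consequence of the definition of `R`, so is `φ_{L(α)}` for any `α ∈ R`. In light of Lemma 4.4,
> `R` is stable by `α ↦ α/2`. Moreover, by horizontal symmetry, `R` is stable by `α ↦ π − α`.
> Repeatedly applying these transformations shows that `R` is dense in `(0, π)`."

(followed by Lemma 3.2, continuity of `α ↦ M_{π/2,α}`, and Proposition 3.13, the uniform version
of Theorem 1.9), where "`φ_{L(α)}` and `φ_{L(β)}` are *asymptotically similar* if
`d_CN(φ_{δL(α)}, φ_{δL(β)}) → 0` as `δ → 0`" (§4.2, display before Lemma 4.4).

This file proves the sentence "Repeatedly applying these transformations shows that `R` is dense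
in `(0, π)`" exactly: an elementary real-variable lemma (any set of reals containing `π/2` and
stable under halving and under `α ↦ π − α` approximates every point of `[0, π]` within `π/2^{n+1}`
for every `n`, hence is dense in `[0, π]`), and its instantiation to DKKMO's set `R` with
asymptotic similarity rendered by the printed coupling distance `LoopConfig.cnLawEDist` (eq. (2))
tending to `0` along `δ → 0⁺`. Of the three inputs of the density step, two are proved here
(`π/2 ∈ R`: the diagonal coupling; stability under `α ↦ π − α`: the exact horizontal symmetry
`cnLawEDist_isoRect_pi_sub_pi_div_two` of `LoopRepresentationUniversality`), and the third —
stability under halving, which is the content of Lemma 4.4 combined with Theorems 1.2 and 1.9 (the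
deep part of the paper: track exchanges, half-plane IIC increments, the drift symmetry
Proposition 3.12, RSW on isoradial lattices) — enters as the explicit hypothesis `hhalf`. Nothing
else of §3–§4 is touched; in particular this file does not discharge `dkkmo_theorem_1_7`.

## Contents

* `exists_mem_abs_sub_le_of_half_mem` — approximation of `[0, π]` by such a set to precision
  `π / 2^(n+1)`, by induction on `n` (halve on `[0, π/2]`, reflect on `(π/2, π]`).
* `Icc_subset_closure_of_half_mem` — such a set is dense in `[0, π]`.
* `cnLawEDist_isoRect_self` — `d_CN(φ_{δL(α)}, φ_{δL(α)}) = 0` (diagonal coupling): `π/2 ∈ R`.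
* `dkkmo_similaritySet_dense_of_half_stable` — the density step of §4.2: if `R` is stable under
  halving then `(0, π) ⊆ closure R`.

## References

* H. Duminil-Copin, K. K. Kozlowski, D. Krachun, I. Manolescu, M. Oulamara, *Rotational
  invariance in critical planar lattice models*, arXiv:2012.11672v2 (2026): §4.2 (proof of
  Theorem 1.7; Lemma 4.4; definition of asymptotic similarity), §1.4 (Theorems 1.7, 1.9).
-/

noncomputable section

open Set MeasureTheory Filter
open scoped ENNReal Real

namespace Literature.Probability.Percolation

open LatticeModels

/-! ### An elementary density lemma: the orbit of `π/2` under halving and `α ↦ π − α` -/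

/-- **Dyadic approximation.** If a set `R` of reals contains `π/2` and is stable under `α ↦ α/2`
and `α ↦ π − α`, then every point of `[0, π]` is within `π / 2^(n+1)` of a point of `R`, for
every `n` (induction on `n`: on `[0, π/2]` halve an approximation of `2x`, on `(π/2, π]` reflect
an approximation of `π − x`). [folklore] -/
theorem exists_mem_abs_sub_le_of_half_mem {R : Set ℝ} (h2 : π / 2 ∈ R)
    (hhalf : ∀ α ∈ R, α / 2 ∈ R) (hsub : ∀ α ∈ R, π - α ∈ R) (n : ℕ) :
    ∀ x ∈ Set.Icc (0 : ℝ) π, ∃ r ∈ R, |x - r| ≤ π / 2 ^ (n + 1) := by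
  induction n with
  | zero =>
    intro x hx
    refine ⟨π / 2, h2, ?_⟩
    rw [zero_add, pow_one, abs_le]
    constructor <;> linarith [hx.1, hx.2]
  | succ n ih =>
    -- the lower half `[0, π/2]`: halve an approximation of `2x`
    have lower : ∀ x ∈ Set.Icc (0 : ℝ) (π / 2), ∃ r ∈ R, |x - r| ≤ π / 2 ^ (n + 1 + 1) := by
      intro x hx
      obtain ⟨r, hr, hxr⟩ := ih (2 * x) ⟨by linarith [hx.1], by linarith [hx.2]⟩
      refine ⟨r / 2, hhalf r hr, ?_⟩
      have habs : |x - r / 2| = |2 * x - r| / 2 := by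
        rw [show x - r / 2 = (2 * x - r) / 2 by ring, abs_div, abs_two]
      rw [habs, pow_succ 2 (n + 1), ← div_div]
      linarith
    intro x hx
    rcases le_or_gt x (π / 2) with hle | hlt
    · exact lower x ⟨hx.1, hle⟩
    · -- the upper half `(π/2, π]`: reflect an approximation of `π - x`
      obtain ⟨r, hr, hxr⟩ := lower (π - x) ⟨by linarith [hx.2], by linarith⟩
      refine ⟨π - r, hsub r hr, ?_⟩
      rw [show x - (π - r) = -(π - x - r) by ring, abs_neg]
      exact hxr

/-- **Density.** A set of reals containing `π/2` and stable under `α ↦ α/2` and `α ↦ π − α` is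
dense in `[0, π]`: `[0, π] ⊆ closure R`. [folklore] -/
theorem Icc_subset_closure_of_half_mem {R : Set ℝ} (h2 : π / 2 ∈ R)
    (hhalf : ∀ α ∈ R, α / 2 ∈ R) (hsub : ∀ α ∈ R, π - α ∈ R) :
    Set.Icc (0 : ℝ) π ⊆ closure R := by
  intro x hx
  rw [Metric.mem_closure_iff]
  intro ε hε
  obtain ⟨n, hn⟩ : ∃ n : ℕ, ((1 : ℝ) / 2) ^ n < ε / π :=
    exists_pow_lt_of_lt_one (div_pos hε Real.pi_pos) (by norm_num)
  obtain ⟨r, hr, hxr⟩ := exists_mem_abs_sub_le_of_half_mem h2 hhalf hsub n x hx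
  refine ⟨r, hr, ?_⟩
  rw [Real.dist_eq]
  have h1 : π / 2 ^ (n + 1) ≤ π * ((1 : ℝ) / 2) ^ n := by
    rw [one_div, inv_pow, ← div_eq_mul_inv, pow_succ]
    exact div_le_div_of_nonneg_left Real.pi_pos.le (by positivity)
      (le_mul_of_one_le_right (by positivity) one_le_two)
  have h2' : π * ((1 : ℝ) / 2) ^ n < ε := by
    have := mul_lt_mul_of_pos_left hn Real.pi_pos
    rwa [mul_div_cancel₀ _ Real.pi_pos.ne'] at this
  exact hxr.trans_lt (h1.trans_lt h2')

/-! ### The density step of §4.2 for DKKMO's set `R` -/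

/-- `d_CN(φ_{δL(α)}, φ_{δL(α)}) = 0` for the printed coupling distance: the diagonal coupling
(`LoopConfig.cnLawEDist_self`). In particular `π/2 ∈ R`. [folklore] -/
theorem cnLawEDist_isoRect_self (α δ : ℝ) :
    RandomPlanarGeometry.LoopConfig.cnLawEDist (isoRectPercolation α) (isoRectLoopConfig δ α)
        (isoRectPercolation α) (isoRectLoopConfig δ α) = 0 :=
  RandomPlanarGeometry.LoopConfig.cnLawEDist_self _ _ (measurableSet_isClose_isoRectLoopConfig δ α δ α)

/-- **The density step of the proof of Theorem 1.7** (DKKMO, arXiv:2012.11672v2, §4.2: "Define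
the set `R = {α ∈ (0, π) : φ_{L(α)}` asymptotically similar to `φ_{L(π/2)}}`. [...] In light of
Lemma 4.4, `R` is stable by `α ↦ α/2`. Moreover, by horizontal symmetry, `R` is stable by
`α ↦ π − α`. Repeatedly applying these transformations shows that `R` is dense in `(0, π)`").
Here asymptotic similarity of `φ_{L(α)}` and `φ_{L(π/2)}` is the printed
`d_CN(φ_{δL(α)}, φ_{δL(π/2)}) → 0` as `δ → 0⁺`, with `d_CN` on laws the coupling distance
`LoopConfig.cnLawEDist` of eq. (2) between the loop representations `isoRectLoopConfig δ α` and
`isoRectLoopConfig δ (π/2)`. Statement: **if** `R` is stable under halving (hypothesis `hhalf` —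
in the source this is Lemma 4.4 together with Theorems 1.2 and 1.9, not proved here), **then**
`(0, π) ⊆ closure R`. The two other inputs are proved: `π/2 ∈ R` (`cnLawEDist_isoRect_self`) and
stability under `α ↦ π − α` (the exact horizontal symmetry
`cnLawEDist_isoRect_pi_sub_pi_div_two`); density is `Icc_subset_closure_of_half_mem`. [cite: arXiv201211672v2, §4.2] -/
theorem dkkmo_similaritySet_dense_of_half_stable
    (hhalf : ∀ α ∈ Set.Ioo (0 : ℝ) π,
      Tendsto (fun δ : ℝ ↦ RandomPlanarGeometry.LoopConfig.cnLawEDist (isoRectPercolation α)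
        (isoRectLoopConfig δ α) (isoRectPercolation (π / 2)) (isoRectLoopConfig δ (π / 2)))
        (nhdsWithin 0 (Set.Ioi 0)) (nhds 0) →
      Tendsto (fun δ : ℝ ↦ RandomPlanarGeometry.LoopConfig.cnLawEDist (isoRectPercolation (α / 2))
        (isoRectLoopConfig δ (α / 2)) (isoRectPercolation (π / 2)) (isoRectLoopConfig δ (π / 2)))
        (nhdsWithin 0 (Set.Ioi 0)) (nhds 0)) :
    Set.Ioo (0 : ℝ) π ⊆ closure {α ∈ Set.Ioo (0 : ℝ) π |
      Tendsto (fun δ : ℝ ↦ RandomPlanarGeometry.LoopConfig.cnLawEDist (isoRectPercolation α)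
        (isoRectLoopConfig δ α) (isoRectPercolation (π / 2)) (isoRectLoopConfig δ (π / 2)))
        (nhdsWithin 0 (Set.Ioi 0)) (nhds 0)} := by
  -- abbreviate the printed distance to `φ_{δL(π/2)}` and the set `R`
  set D : ℝ → ℝ → ℝ≥0∞ := fun α δ ↦ RandomPlanarGeometry.LoopConfig.cnLawEDist (isoRectPercolation α)
    (isoRectLoopConfig δ α) (isoRectPercolation (π / 2)) (isoRectLoopConfig δ (π / 2)) with hD
  set R : Set ℝ := {α ∈ Set.Ioo (0 : ℝ) π | Tendsto (D α) (nhdsWithin 0 (Set.Ioi 0)) (nhds 0)} with hR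
  change ∀ α ∈ Set.Ioo (0 : ℝ) π, Tendsto (D α) (nhdsWithin 0 (Set.Ioi 0)) (nhds 0) →
    Tendsto (D (α / 2)) (nhdsWithin 0 (Set.Ioi 0)) (nhds 0) at hhalf
  change Set.Ioo (0 : ℝ) π ⊆ closure R
  -- `π/2 ∈ R`: the distance of `φ_{δL(π/2)}` to itself vanishes identically
  have h2 : π / 2 ∈ R := by
    refine ⟨⟨by positivity, by linarith [Real.pi_pos]⟩, ?_⟩
    have h0 : D (π / 2) = fun _ ↦ 0 := funext fun δ ↦ cnLawEDist_isoRect_self (π / 2) δ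
    rw [h0]
    exact tendsto_const_nhds
  -- stability under halving: the hypothesis
  have hhalf' : ∀ α ∈ R, α / 2 ∈ R := fun α hα ↦
    ⟨⟨by linarith [hα.1.1], by linarith [hα.1.2, Real.pi_pos]⟩, hhalf α hα.1 hα.2⟩
  -- stability under `α ↦ π - α`: exact horizontal symmetry
  have hsub : ∀ α ∈ R, π - α ∈ R := by
    rintro α ⟨hα, hT⟩
    refine ⟨⟨by linarith [hα.2], by linarith [hα.1]⟩, ?_⟩
    have heq : D (π - α) = D α := funext fun δ ↦ cnLawEDist_isoRect_pi_sub_pi_div_two α δ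
    rwa [heq]
  exact fun α hα ↦ Icc_subset_closure_of_half_mem h2 hhalf' hsub ⟨hα.1.le, hα.2.le⟩


/-- **Density and continuity force `M_{π/2,α} = id` everywhere** (DKKMO, arXiv:2012.11672v2,
§4.2, proof of Theorem 1.7: "Fix `α ∈ R`. That `φ_{L(π/2)}` and `φ_{L(α)}` are asymptotically
similar yields `M_{π/2,α} = id`. Due to the continuity of `α ↦ M_{π/2,α}` (see Lemma 3.2) and to
`R` being dense in `(0, π)`, we conclude that `M_{π/2,α} = id` for all `α ∈ (0, π)`"), as the
elementary extension step it is, for an arbitrary map `M` on the angles with values in a Hausdorff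
space (in the source: the drift matrices `M_{π/2,α}` of Theorem 1.9, eq. (95), which are not
constructed here) and an arbitrary value `e` (in the source: `id`). Hypotheses, all inputs of the
printed argument that this layer does not prove: `hM` — continuity of `M` on `(0, π)` (Lemma 3.2);
`hR` — asymptotic similarity to `φ_{L(π/2)}` forces `M α = e` (Theorem 1.9 and the RSW shape
argument); `hhalf` — `R` is stable under halving (Lemma 4.4 with Theorems 1.2, 1.9). Conclusion:
`M α = e` for every `α ∈ (0, π)` (`dkkmo_similaritySet_dense_of_half_stable` and
`Set.EqOn.of_subset_closure`). [cite: arXiv201211672v2, §4.2] -/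
theorem dkkmo_eqOn_of_similaritySet_of_half_stable {X : Type*} [TopologicalSpace X] [T2Space X]
    {M : ℝ → X} {e : X} (hM : ContinuousOn M (Set.Ioo (0 : ℝ) π))
    (hR : ∀ α ∈ Set.Ioo (0 : ℝ) π,
      Tendsto (fun δ : ℝ ↦ RandomPlanarGeometry.LoopConfig.cnLawEDist (isoRectPercolation α)
        (isoRectLoopConfig δ α) (isoRectPercolation (π / 2)) (isoRectLoopConfig δ (π / 2)))
        (nhdsWithin 0 (Set.Ioi 0)) (nhds 0) → M α = e)
    (hhalf : ∀ α ∈ Set.Ioo (0 : ℝ) π,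
      Tendsto (fun δ : ℝ ↦ RandomPlanarGeometry.LoopConfig.cnLawEDist (isoRectPercolation α)
        (isoRectLoopConfig δ α) (isoRectPercolation (π / 2)) (isoRectLoopConfig δ (π / 2)))
        (nhdsWithin 0 (Set.Ioi 0)) (nhds 0) →
      Tendsto (fun δ : ℝ ↦ RandomPlanarGeometry.LoopConfig.cnLawEDist (isoRectPercolation (α / 2))
        (isoRectLoopConfig δ (α / 2)) (isoRectPercolation (π / 2)) (isoRectLoopConfig δ (π / 2)))
        (nhdsWithin 0 (Set.Ioi 0)) (nhds 0)) :
    ∀ α ∈ Set.Ioo (0 : ℝ) π, M α = e := by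
  have hdense := dkkmo_similaritySet_dense_of_half_stable hhalf
  have heq : Set.EqOn M (fun _ ↦ e) {α ∈ Set.Ioo (0 : ℝ) π |
      Tendsto (fun δ : ℝ ↦ RandomPlanarGeometry.LoopConfig.cnLawEDist (isoRectPercolation α)
        (isoRectLoopConfig δ α) (isoRectPercolation (π / 2)) (isoRectLoopConfig δ (π / 2)))
        (nhdsWithin 0 (Set.Ioi 0)) (nhds 0)} := fun α hα ↦ hR α hα.1 hα.2
  exact heq.of_subset_closure hM continuousOn_const (fun α hα ↦ hα.1) hdense

end Literature.Probability.Percolation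

end
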